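import Literature.AlgebraicTopology.SingularHomology.CupProductSupports
import Literature.AlgebraicTopology.SingularHomology.CompactSupportCap
import Literature.AlgebraicTopology.SingularHomology.LocalHomology
import HarnessLib

/-!
# The support of a cap product: `a ⌢ z` lies in `H_q(U)` when `a` vanishes outside `U`

A. Hatcher, *Algebraic Topology* (2002), §3.3, p. 240: "the cap product restricts to
`Cₖ(A; R) × Cˡ(X; R) → Cₖ₋ₗ(A; R)`" (the back face of a simplex in `A` lies in `A`), p. 239 (the
cap product with `Cˡ(X, A; R)` kills `Cₖ(A; R)`: the front face of a simplex in `A` lies in `A`),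
and Lemma 3.36 (p. 246): for `K ⊆ U` open, "`μ_K ⌢ φ`" is computed in `H_{n-k}(U)` by capping a
representative made of chains in `U` ("via barycentric subdivision"). The same three remarks give
the **locality of the absolute cap product**, which this file proves for the tree's
`capProduct` (`CapProduct.lean`):

* `capProduct_mem_range_map_of_map_eq_zero` — if `X = U ∪ V` with `U`, `V` open and
  `a ∈ Hᵖ(X; R)` restricts to `0` on `V`, then for every `z ∈ Hₙ(X; M)` the class
  `a ⌢ z ∈ H_q(X; M)` (`p + q = n`) lies in the image of `H_q(U; M) → H_q(X; M)`;
* `exists_capProduct_eq_smul_map_of_map_eq_zero` — hence, if `a` vanishes on `X ∖ K` for a closed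
  `K ⊆ U` and `H_q(U; M)` is generated by one class `g`, then `a ⌢ z = m • i_* g`.

Proof (Hatcher's, at chain level, in the concrete model `csingularChainComplex`): represent `a`
by a cocycle `φ` vanishing on every simplex inside `V` (`exists_rep_eq_zero_of_map_eq_zero`,
`CupProductSupports.lean`) and `z` by a `{U, V}`-small cycle `x = x_U + x_V`
(`isIso_homologyMap_ι_sup`, Hatcher Prop. 2.21); then `x ⌢ φ = x_U ⌢ φ`
(`ccapChain_eq_zero_of_mem_relCochains`) is a cycle made of chains in `U`
(`ccapChain_mem_chainsIn`), whose class in `H_q(C(U)) = H_q(↥U)` (`subspaceIso`) maps to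
`a ⌢ z` (`capProduct_π_homologyCls`).

This is the tool by which the Poincaré dual `ẑ ⌢ π^* u` of a class pulled back along a collapse
`π : X → N̂` of an open piece `N ⊆ X` (a Thom class `u`, vanishing off the zero section) is seen to
be a class OF THE PIECE, hence a multiple of its core sphere — the homological form of "the dual
class of a submanifold is supported in a tubular neighbourhood" (Milnor–Stasheff, *Characteristic
classes* (1974), §11, Thm. 11.3 / Problem 11-C) used for the `E₈` plumbing
(`Literature.Topology.FourManifolds.HomotopySphere.exists_intersectionForm_equivalent_e8Form`,
Kosinski 1993, VI.12). Everything is proved; no definitions, no named facts (D-0026).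

## References

* A. Hatcher, *Algebraic Topology*, CUP 2002, §3.3 pp. 239–240 (relative cap products),
  Lemma 3.36 p. 246, Prop. 2.21. [HatcherAT2002]
* J. Milnor, J. Stasheff, *Characteristic classes*, Princeton 1974, §11, Thm. 11.3 and
  Problem 11-C. [MilnorStasheff1974]
-/

noncomputable section

-- as in `SingularChainsConcrete` / `CompactSupportCap`: chains of the concrete complex are
-- `Finsupp`s up to unfolding of semireducible definitions
set_option backward.isDefEq.respectTransparency false

open CategoryTheory Limits

universe u v

namespace Literature.AlgebraicTopology.SingularHomology

variable (R : Type v) [CommRing R] (M : Type v) [AddCommGroup M] [Module R M]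
variable {X : Type u} [TopologicalSpace X]

open singularCochainComplex

/-- For a cocycle `φ` and a concrete cycle `x ∈ Cₙ(X; M)`, the capped chain `x ⌢ φ ∈ C_q(X; M)`
is a cycle: `∂(x ⌢ φ) = ±∂x ⌢ φ = 0` (Hatcher 2002, §3.3 p. 240).
[cite: HatcherAT2002, §3.3 p. 240] -/
theorem d_ccapChain_iCocycles_eq_zero {p q n : ℕ} (h : p + q = n) (φ : cocycles R R X p)
    (x : (csingularChainComplex R M X).X n)
    (hx : (csingularChainComplex R M X).d n ((ComplexShape.down ℕ).next n) x = 0) :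
    (csingularChainComplex R M X).d q ((ComplexShape.down ℕ).next q)
      (ccapChain M h (iCocycles R R X p φ) x) = 0 := by
  cases q with
  | zero =>
    rw [(csingularChainComplex R M X).shape 0 _ (by simp)]
    rfl
  | succ q' =>
    obtain rfl : n = (p + q') + 1 := by omega
    rw [ChainComplex.next_nat_succ] at hx ⊢
    rw [d_ccapChain_iCocycles_apply (rfl : p + q' = p + q'), hx, map_zero, smul_zero]

/-- **Locality of the cap product** (Hatcher 2002, §3.3 pp. 239–240, Lemma 3.36): if `X = U ∪ V`
with `U`, `V` open and `a ∈ Hᵖ(X; R)` restricts to zero on `V`, then `a ⌢ z` lies in the image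
of `H_q(U; M) → H_q(X; M)` for every `z ∈ Hₙ(X; M)`, `p + q = n`.
[cite: HatcherAT2002, §3.3 pp. 239–240 and Lemma 3.36] -/
theorem capProduct_mem_range_map_of_map_eq_zero {p q n : ℕ} (h : p + q = n) {U V : Set X}
    (hU : IsOpen U) (hV : IsOpen V) (hUV : U ∪ V = Set.univ)
    (a : singularCohomology R R X p) (ha : singularCohomology.map R R (subsetIncl V) p a = 0)
    (z : singularHomology R M X n) :
    ∃ y : singularHomology R M ↥U q,
      singularHomology.map R M (subsetIncl U) q y = capProduct h a z := by
  classical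
  -- (1) a representative of `a` vanishing on the simplices inside `V`
  obtain ⟨φ, rfl, hφV⟩ := exists_rep_eq_zero_of_map_eq_zero R V a ha
  -- (2) a `{U, V}`-small representative of `z` in the concrete model
  haveI := isIso_homologyMap_ι_sup R M hU hV hUV n
  obtain ⟨s, hs⟩ : ∃ s, HomologicalComplex.homologyMap
      (chainsInSub R M X U ⊔ chainsInSub R M X V).ι n s = (csingularHomology.compIso R M X n).inv z :=
    ⟨inv (HomologicalComplex.homologyMap (chainsInSub R M X U ⊔ chainsInSub R M X V).ι n)
      ((csingularHomology.compIso R M X n).inv z), by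
      rw [← ModuleCat.comp_apply, IsIso.inv_hom_id, ModuleCat.id_apply]⟩
  obtain ⟨x, hx, rfl⟩ := homologyCls_surjective s
  have hx1 : (csingularChainComplex R M X).d n ((ComplexShape.down ℕ).next n) x.1 = 0 := by
    have e := congrArg Subtype.val hx
    rw [Subcomplex.toComplex_d_apply_val] at e
    exact e
  obtain ⟨cU, hcU, cV, hcV, hsum⟩ := Submodule.mem_sup.mp x.2
  -- (3) the capped chain `w = x ⌢ φ = x_U ⌢ φ`, a cycle of chains in `U`
  have hcapV : ccapChain M h (iCocycles R R X p φ) cV = 0 :=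
    ccapChain_eq_zero_of_mem_relCochains h (A := V) (fun σ hσ => hφV σ hσ) hcV
  have hcapx : ccapChain M h (iCocycles R R X p φ) x.1 =
      ccapChain M h (iCocycles R R X p φ) cU := by
    rw [← hsum, map_add, hcapV, add_zero]
  have hwU : ccapChain M h (iCocycles R R X p φ) cU ∈ chainsInSub R M X U q :=
    ccapChain_mem_chainsIn h _ hcU
  have hdw : (csingularChainComplex R M X).d q ((ComplexShape.down ℕ).next q)
      (ccapChain M h (iCocycles R R X p φ) cU) = 0 := by
    rw [← hcapx]; exact d_ccapChain_iCocycles_eq_zero R M h φ x.1 hx1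
  -- (4) its class in `H_q(C(U)) ≅ H_q(↥U)`
  have hdw' : (chainsInSub R M X U).toComplex.d q ((ComplexShape.down ℕ).next q)
      ⟨ccapChain M h (iCocycles R R X p φ) cU, hwU⟩ = 0 := by
    apply Subtype.ext
    rw [Subcomplex.toComplex_d_apply_val]
    exact hdw
  refine ⟨(csingularHomology.compIso R M ↥U q).hom
    (HomologicalComplex.homologyMap (subspaceIso R M X U).inv q (homologyCls _ hdw')), ?_⟩
  -- (5) the chase
  rw [← ModuleCat.comp_apply, ← csingularHomology.map_comp_compIso_hom, ModuleCat.comp_apply]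
  change (csingularHomology.compIso R M X q).hom (HomologicalComplex.homologyMap
    (csingularChainComplex.map R M (subsetIncl U)) q (HomologicalComplex.homologyMap
      (subspaceIso R M X U).inv q (homologyCls _ hdw'))) = _
  have hfac : csingularChainComplex.map R M (subsetIncl U) =
      (subspaceIso R M X U).hom ≫ (chainsInSub R M X U).ι := (subspaceLift_ι R M U).symm
  rw [hfac, HomologicalComplex.homologyMap_comp, ModuleCat.comp_apply, ← ModuleCat.comp_apply
    (HomologicalComplex.homologyMap (subspaceIso R M X U).inv q), ← HomologicalComplex.homologyMap_comp,
    Iso.inv_hom_id, HomologicalComplex.homologyMap_id, ModuleCat.id_apply,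
    homologyMap_homologyCls, csingularHomology.compIso_hom_homologyCls]
  -- the right-hand side
  have hz : z = (csingularHomology.compIso R M X n).hom
      (HomologicalComplex.homologyMap (chainsInSub R M X U ⊔ chainsInSub R M X V).ι n
        (homologyCls x hx)) := by
    rw [hs, ← ModuleCat.comp_apply, Iso.inv_hom_id, ModuleCat.id_apply]
  rw [hz, homologyMap_homologyCls, csingularHomology.compIso_hom_homologyCls,
    capProduct_π_homologyCls]
  refine homologyCls_congr ?_ _ _
  change (csingularChainComplex.compIso R M X).hom.f q (ccapChain M h (iCocycles R R X p φ) cU) =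
    capChain M h (iCocycles R R X p φ) ((csingularChainComplex.compIso R M X).hom.f n x.1)
  rw [← hcapx, ← ModuleCat.comp_apply, ccapChain_comp_compIso_hom, ModuleCat.comp_apply]

/-- **Corollary (the Poincaré dual of a class supported in a piece is a class of the piece).**
If `K ⊆ U ⊆ X` with `K` closed and `U` open, `a ∈ Hᵖ(X; R)` restricts to zero on `X ∖ K`, and
`H_q(U; M)` is generated by one class `g`, then `a ⌢ z = m • i_* g` for some `m ∈ R`, for every
`z ∈ Hₙ(X; M)` (`p + q = n`). (Milnor–Stasheff 1974, §11: the dual class of a submanifold is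
supported in a tubular neighbourhood; here in the form used for the core spheres of a plumbing.)
[cite: HatcherAT2002, §3.3 Lemma 3.36] [cite: MilnorStasheff1974, §11 Problem 11-C] -/
theorem exists_capProduct_eq_smul_map_of_map_eq_zero {p q n : ℕ} (h : p + q = n) {U K : Set X}
    (hU : IsOpen U) (hK : IsClosed K) (hKU : K ⊆ U)
    (a : singularCohomology R R X p) (ha : singularCohomology.map R R (subsetIncl Kᶜ) p a = 0)
    (z : singularHomology R M X n) (g : singularHomology R M ↥U q)
    (hg : ∀ y : singularHomology R M ↥U q, ∃ m : R, y = m • g) :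
    ∃ m : R, capProduct h a z = m • singularHomology.map R M (subsetIncl U) q g := by
  have hUV : U ∪ Kᶜ = Set.univ :=
    Set.eq_univ_of_forall fun x => by
      by_cases hx : x ∈ K
      · exact Or.inl (hKU hx)
      · exact Or.inr hx
  obtain ⟨y, hy⟩ := capProduct_mem_range_map_of_map_eq_zero R M h hU hK.isOpen_compl hUV a ha z
  obtain ⟨m, rfl⟩ := hg y
  exact ⟨m, by rw [← hy, map_smul]⟩

end Literature.AlgebraicTopology.SingularHomology
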